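import Summits.Parity.GeneralizedHardyLittlewood.Theorems.LeeYangFibresCellParityLawKernelDefs
import Summits.Parity.GeneralizedHardyLittlewood.Theorems.LeeYangFibresCellParityLawMertensAux
import Summits.Parity.GeneralizedHardyLittlewood.Theorems.LeeYangFibresCellParityLawWalshStep
import Literature.NumberTheory.Sieve.RoughCellDensity
import Literature.NumberTheory.Sieve.LinearEquationsInPrimesCountSandwich
import HarnessLib

/-!
# Route `LeeYangFibres`, crux `CellParityLaw` (stmt-Parity-14109), line `section-annihilator`:
# the registered stub `stub_geThreeMainTerm` — main-term conversion of the `u ≥ 3` rung (skeleton v13)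

We prove `GeThreeMainTerm : SectionMertensTwo → ModelDensityAlladi → MainTermConversion` (vocabulary
file `LeeYangFibresCellParityLawKernelDefs`). Write `ℓ = log N`, `H = H_{Ψ,i} = sectionH Ψ i ≥ 0`
(`MertensAux.sectionH_nonneg`), `G = e^γ V(N^{1/u})`, `I_m = roughCellDensity m`, `a_m = modelDensity N u m`
and `u' = log x/log z = log(2LN)/log(N^{1/u}) = u + ε`, `ε = u log(2L)/ℓ ∈ [0, 1]` once `N ≥ (2L)^u`
(`GeThreeMainTermAux.log_ratio_eq`). The two hypotheses give `|G - uH/ℓ| ≤ C₁ H/ℓ²` (so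
`|G| ≤ (u + C₁) H/ℓ`, `GeThreeMainTermAux.abs_main_le`), `|a_m - I_m(u)/ℓ| ≤ C₂/ℓ²` and
`|I_m(u') - I_m(u)| ≤ C₂ ε`; with `0 ≤ I_m(u) ≤ u` (`roughCellDensity_nonneg/_le`) the identity
`(I_m(u')/u') G - a_m H = [I_m(u') - I_m(u)] G/u' + I_m(u) (1/u' - 1/u) G + (I_m(u)/u)(G - uH/ℓ)
 + (I_m(u)/ℓ - a_m) H`
bounds the difference by `K H/ℓ²`, `K = (C₂ + 1) log(2L) (u + C₁) + C₁ + C₂`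
(`GeThreeMainTermAux.core_bound`); the weight `w = 1 + (δ-1)(-1)^m` has `|w| ≤ 2` for `δ ∈ [0, 2]`
(`WalshStepAux.abs_parityWeight_le`).
Pure real analysis; constants `C = 2K + u + C₁`, `N₀ = max N₁ (max N₂ (max 3 ((2L)^u)))`.
-/

noncomputable section

open scoped BigOperators Classical
open Finset Literature.NumberTheory.Sieve

namespace Summit.Parity.GeneralizedHardyLittlewood.Cruxes.CellParityLaw.SectionAnnihilator

namespace GeThreeMainTermAux

/-! ## Elementary real-analysis lemmas -/

/-- From `|G - uH/ℓ| ≤ C₁ H/ℓ²` with `ℓ ≥ 1`, `H, u, C₁ ≥ 0`: `|G| ≤ (u + C₁) H/ℓ`. -/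
theorem abs_main_le {G H ℓ u C₁ : ℝ} (hℓ : 1 ≤ ℓ) (hu : 0 ≤ u) (hH : 0 ≤ H) (hC₁ : 0 ≤ C₁)
    (hG : |G - u * H / ℓ| ≤ C₁ * H / ℓ ^ 2) : |G| ≤ (u + C₁) * H / ℓ := by
  have hℓ0 : 0 < ℓ := by linarith
  have h2 : H / ℓ ^ 2 ≤ H / ℓ := div_le_div_of_nonneg_left hH hℓ0 (by nlinarith)
  have h1 : |G| ≤ |G - u * H / ℓ| + |u * H / ℓ| := by
    have h := abs_add_le (G - u * H / ℓ) (u * H / ℓ)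
    rwa [sub_add_cancel] at h
  rw [abs_of_nonneg (by positivity : 0 ≤ u * H / ℓ)] at h1
  have h3 : C₁ * H / ℓ ^ 2 ≤ C₁ * H / ℓ := by
    rw [mul_div_assoc, mul_div_assoc]
    exact mul_le_mul_of_nonneg_left h2 hC₁
  calc |G| ≤ C₁ * H / ℓ + u * H / ℓ := by linarith
    _ = (u + C₁) * H / ℓ := by ring

/-- **The core bound.** With `u' = u + ε`, `ε = u·lg/ℓ ≥ 0`, `|G - uH/ℓ| ≤ C₁ H/ℓ²`,
`|I' - I| ≤ C₂ ε`, `0 ≤ I ≤ u`, `|a - I/ℓ| ≤ C₂/ℓ²`: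
`|(I'/u') G - a H| ≤ ((C₂ + 1) lg (u + C₁) + C₁ + C₂) H/ℓ²` (four-term decomposition). -/
theorem core_bound {G H ℓ u ε I I' a C₁ C₂ lg : ℝ} (hℓ : 1 ≤ ℓ) (hu : 2 ≤ u) (hH : 0 ≤ H)
    (hC₁ : 0 ≤ C₁) (hC₂ : 0 ≤ C₂) (hlg : 0 ≤ lg)
    (hG : |G - u * H / ℓ| ≤ C₁ * H / ℓ ^ 2) (hε : ε = u * lg / ℓ) (hI : |I' - I| ≤ C₂ * ε) (hI0 : 0 ≤ I) (hIu : I ≤ u) (ha : |a - I / ℓ| ≤ C₂ / ℓ ^ 2) :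
    |I' / (u + ε) * G - a * H| ≤ ((C₂ + 1) * lg * (u + C₁) + C₁ + C₂) * H / ℓ ^ 2 := by
  have hℓ0 : 0 < ℓ := by linarith
  have hu0 : 0 < u := by linarith
  have hε0 : 0 ≤ ε := by rw [hε]; positivity
  have hu'0 : 0 < u + ε := by linarith
  have hGabs : |G| ≤ (u + C₁) * H / ℓ := abs_main_le hℓ hu0.le hH hC₁ hG
  have hB0 : 0 ≤ (u + C₁) * H / ℓ := by positivity
  -- the four-term decomposition
  have hdecomp : I' / (u + ε) * G - a * H =
      (I' - I) / (u + ε) * G + I * (1 / (u + ε) - 1 / u) * G + I / u * (G - u * H / ℓ) +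
        (I / ℓ - a) * H := by
    field_simp
    ring
  -- T1
  have hT1 : |(I' - I) / (u + ε) * G| ≤ C₂ * lg * (u + C₁) * H / ℓ ^ 2 := by
    rw [abs_mul, abs_div, abs_of_pos hu'0]
    have h1 : |I' - I| / (u + ε) ≤ C₂ * ε / u :=
      (div_le_div_of_nonneg_right hI hu'0.le).trans
        (div_le_div_of_nonneg_left (by positivity) hu0 (by linarith))
    calc |I' - I| / (u + ε) * |G| ≤ C₂ * ε / u * ((u + C₁) * H / ℓ) :=
          mul_le_mul h1 hGabs (abs_nonneg _) (by positivity)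
      _ = C₂ * lg * (u + C₁) * H / ℓ ^ 2 := by
          rw [hε]; field_simp
  -- T2
  have hT2 : |I * (1 / (u + ε) - 1 / u) * G| ≤ lg * (u + C₁) * H / ℓ ^ 2 := by
    have h1 : |1 / (u + ε) - 1 / u| = ε / (u * (u + ε)) := by
      rw [abs_sub_comm, abs_of_nonneg]
      · field_simp; ring
      · rw [sub_nonneg]
        exact one_div_le_one_div_of_le hu0 (by linarith)
    have h2 : ε / (u * (u + ε)) ≤ ε / (u * u) :=
      div_le_div_of_nonneg_left hε0 (by positivity) (by nlinarith)
    rw [abs_mul, abs_mul, abs_of_nonneg hI0, h1]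
    calc I * (ε / (u * (u + ε))) * |G| ≤ u * (ε / (u * u)) * ((u + C₁) * H / ℓ) := by
          apply mul_le_mul (mul_le_mul hIu h2 (by positivity) hu0.le) hGabs (abs_nonneg _)
          positivity
      _ = lg * (u + C₁) * H / ℓ ^ 2 := by
          rw [hε]; field_simp
  -- T3
  have hT3 : |I / u * (G - u * H / ℓ)| ≤ C₁ * H / ℓ ^ 2 := by
    rw [abs_mul, abs_of_nonneg (by positivity : 0 ≤ I / u)]
    have h1 : I / u ≤ 1 := (div_le_one hu0).mpr hIu
    calc I / u * |G - u * H / ℓ| ≤ 1 * (C₁ * H / ℓ ^ 2) :=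
          mul_le_mul h1 hG (abs_nonneg _) zero_le_one
      _ = C₁ * H / ℓ ^ 2 := one_mul _
  -- T4
  have hT4 : |(I / ℓ - a) * H| ≤ C₂ * H / ℓ ^ 2 := by
    rw [abs_mul, abs_of_nonneg hH, abs_sub_comm]
    calc |a - I / ℓ| * H ≤ C₂ / ℓ ^ 2 * H := mul_le_mul_of_nonneg_right ha hH
      _ = C₂ * H / ℓ ^ 2 := by ring
  rw [hdecomp]
  calc |(I' - I) / (u + ε) * G + I * (1 / (u + ε) - 1 / u) * G + I / u * (G - u * H / ℓ) +
          (I / ℓ - a) * H|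
        ≤ |(I' - I) / (u + ε) * G| + |I * (1 / (u + ε) - 1 / u) * G| + |I / u * (G - u * H / ℓ)| +
          |(I / ℓ - a) * H| := by
        refine (abs_add_le _ _).trans (add_le_add ?_ le_rfl)
        refine (abs_add_le _ _).trans (add_le_add ?_ le_rfl)
        exact abs_add_le _ _
    _ ≤ C₂ * lg * (u + C₁) * H / ℓ ^ 2 + lg * (u + C₁) * H / ℓ ^ 2 + C₁ * H / ℓ ^ 2 +
          C₂ * H / ℓ ^ 2 := by linarith
    _ = ((C₂ + 1) * lg * (u + C₁) + C₁ + C₂) * H / ℓ ^ 2 := by ring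

/-- The real sieve parameter: `log(2LN)/log(N^{1/u}) = u + u log(2L)/log N` (`L ≥ 1`, `N ≥ 2`, `u ≥ 1`). -/
theorem log_ratio_eq {L N u : ℕ} (hL : 1 ≤ L) (hN : 2 ≤ N) (hu : 1 ≤ u) :
    Real.log (xOf L N) / Real.log (zOf N u) = u + u * Real.log (2 * L) / Real.log N := by
  have hN0 : (0 : ℝ) < N := by exact_mod_cast (show 0 < N by omega)
  have hL0 : (0 : ℝ) < 2 * L := by exact_mod_cast (show 0 < 2 * L by omega)
  have hu0 : (u : ℝ) ≠ 0 := by exact_mod_cast (show u ≠ 0 by omega)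
  have hℓ : Real.log N ≠ 0 :=
    (Real.log_pos (by exact_mod_cast (show 1 < N by omega))).ne'
  simp only [xOf, zOf]
  rw [Real.log_mul hL0.ne' hN0.ne', Real.log_rpow hN0]
  field_simp
  ring

/-- Threshold facts: for `N ≥ 3`, `1 ≤ log N`; for `N ≥ (2L)^u` (`L ≥ 1`), `u log(2L) ≤ log N`. -/
theorem log_threshold {L N u : ℕ} (hL : 1 ≤ L) (hN3 : 3 ≤ N) (hNL : (2 * L) ^ u ≤ N) :
    1 ≤ Real.log N ∧ (u : ℝ) * Real.log (2 * L) ≤ Real.log N := by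
  have hN0 : (0 : ℝ) < N := by exact_mod_cast (show 0 < N by omega)
  have hL0 : (0 : ℝ) < 2 * L := by exact_mod_cast (show 0 < 2 * L by omega)
  refine ⟨?_, ?_⟩
  · rw [Real.le_log_iff_exp_le hN0]
    have h3 : (3 : ℝ) ≤ N := by exact_mod_cast hN3
    linarith [Real.exp_one_lt_d9]
  · rw [← Real.log_pow]
    refine Real.log_le_log (pow_pos hL0 u) ?_
    exact_mod_cast hNL

end GeThreeMainTermAux

open GeThreeMainTermAux in
/-- **`stub_geThreeMainTerm`** (registered stub of the line `section-annihilator`, skeleton v13): the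
main-term conversion `MainTermConversion` from the two-sided Mertens evaluation `SectionMertensTwo` and
Alladi's densities with rate `ModelDensityAlladi`, with `C = 2K + u + C₁⁺`,
`K = (C₂ + 1) log(2L) (u + C₁⁺) + C₁⁺ + C₂`, `C₁⁺ = max C₁ 0`, and `N₀ = max N₁ (max N₂ (max 3 ((2L)^u)))`. -/
theorem stub_geThreeMainTerm : GeThreeMainTerm := by
  intro hM2 hAl t L u hu
  obtain ⟨C₁, N₁, h1⟩ := hM2 t L u hu
  obtain ⟨C₂, hC₂, N₂, h2a, h2b⟩ := hAl u hu
  have hC₁' : 0 ≤ max C₁ 0 := le_max_right _ _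
  have hlg : 0 ≤ Real.log (2 * L) := by
    have h : Real.log (2 * L) = Real.log ((2 * L : ℕ) : ℝ) := by push_cast; rfl
    rw [h]; exact Real.log_natCast_nonneg _
  have hu0 : (0 : ℝ) ≤ u := Nat.cast_nonneg u
  have hK : 0 ≤ (C₂ + 1) * Real.log (2 * L) * (u + max C₁ 0) + max C₁ 0 + C₂ := by positivity
  refine ⟨2 * ((C₂ + 1) * Real.log (2 * L) * (u + max C₁ 0) + max C₁ 0 + C₂) + (u + max C₁ 0),
    by positivity, max N₁ (max N₂ (max 3 ((2 * L) ^ u))), fun N hN Ψ hΨ hL i hg1 hne => ?_⟩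
  -- unpacking `N ≥ N₀`
  have hN₁ : N₁ ≤ N := le_trans (le_max_left _ _) hN
  have hN₂ : N₂ ≤ N := le_trans ((le_max_left _ _).trans (le_max_right _ _)) hN
  have hN3 : 3 ≤ N :=
    le_trans (((le_max_left _ _).trans (le_max_right _ _)).trans (le_max_right _ _)) hN
  have hNL : (2 * L) ^ u ≤ N :=
    le_trans (((le_max_right _ _).trans (le_max_right _ _)).trans (le_max_right _ _)) hN
  have hL1 : 1 ≤ L := by
    have h : (1 : ℝ) ≤ L := one_le_of_affLinSize_le Ψ hΨ hL i
    exact_mod_cast h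
  have hu1 : 1 ≤ u := by omega
  have hu2 : (2 : ℝ) ≤ u := by exact_mod_cast hu
  obtain ⟨hℓ1, hεℓ⟩ := log_threshold hL1 hN3 hNL
  have hℓ0 : 0 < Real.log N := by linarith
  have hH : 0 ≤ sectionH Ψ i := MertensAux.sectionH_nonneg Ψ hΨ i hne
  -- hypothesis 1 with a nonnegative constant
  have hG : |Real.exp Real.eulerMascheroniConstant *
        ∏ p ∈ Nat.primesBelow ⌈zOf N u⌉₊, (1 - sectionDensity Ψ i p) -
      u * sectionH Ψ i / Real.log N| ≤ max C₁ 0 * sectionH Ψ i / Real.log N ^ 2 :=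
    (h1 N hN₁ Ψ hΨ hL i hg1 hne).trans (div_le_div_of_nonneg_right
      (mul_le_mul_of_nonneg_right (le_max_left _ _) hH) (by positivity))
  have hGabs := abs_main_le hℓ1 hu0 hH hC₁' hG
  refine ⟨?_, fun δ hδ0 hδ2 m hm F' hF' => ?_⟩
  · -- clause (a)
    refine (le_abs_self _).trans (hGabs.trans ?_)
    refine div_le_div_of_nonneg_right (mul_le_mul_of_nonneg_right ?_ hH) hℓ0.le
    linarith
  · -- clause (b)
    rw [log_ratio_eq hL1 (by omega) hu1]
    set ε : ℝ := u * Real.log (2 * L) / Real.log N with hε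
    have hε0 : 0 ≤ ε := by positivity
    have hε1 : ε ≤ 1 := (div_le_one hℓ0).mpr hεℓ
    have hI : |roughCellDensity m (u + ε) - roughCellDensity m u| ≤ C₂ * ε := by
      have h := h2b m hm (u + ε) (by linarith) (by linarith)
      rwa [add_sub_cancel_left] at h
    have ha := h2a N hN₂ m hm
    have hcore := core_bound hℓ1 hu2 hH hC₁' hC₂ hlg hG hε hI (roughCellDensity_nonneg m u)
      (roughCellDensity_le hm (by linarith)) ha
    have hw := WalshStepAux.abs_parityWeight_le hδ0 hδ2 m
    set G := Real.exp Real.eulerMascheroniConstant *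
      ∏ p ∈ Nat.primesBelow ⌈zOf N u⌉₊, (1 - sectionDensity Ψ i p) with hGdef
    set w := 1 + (δ - 1) * (-1 : ℝ) ^ m with hwdef
    set K := (C₂ + 1) * Real.log (2 * L) * (u + max C₁ 0) + max C₁ 0 + C₂ with hKdef
    calc |w * (roughCellDensity m (u + ε) / (u + ε)) * G * F' -
            w * modelDensity N u m * sectionH Ψ i * F'|
          = |w| * |roughCellDensity m (u + ε) / (u + ε) * G - modelDensity N u m * sectionH Ψ i| *
              F' := by
          rw [show w * (roughCellDensity m (u + ε) / (u + ε)) * G * F' -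
              w * modelDensity N u m * sectionH Ψ i * F' =
              w * (roughCellDensity m (u + ε) / (u + ε) * G - modelDensity N u m * sectionH Ψ i) * F'
              by ring, abs_mul, abs_mul, abs_of_nonneg hF']
      _ ≤ 2 * (K * sectionH Ψ i / Real.log N ^ 2) * F' :=
          mul_le_mul_of_nonneg_right (mul_le_mul hw hcore (abs_nonneg _) zero_le_two) hF'
      _ ≤ (2 * K + (u + max C₁ 0)) * sectionH Ψ i * F' / Real.log N ^ 2 := by
          have h : 0 ≤ (u + max C₁ 0) * sectionH Ψ i * F' / Real.log N ^ 2 := by positivity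
          have h' : (2 * K + (u + max C₁ 0)) * sectionH Ψ i * F' / Real.log N ^ 2 =
              2 * (K * sectionH Ψ i / Real.log N ^ 2) * F' +
                (u + max C₁ 0) * sectionH Ψ i * F' / Real.log N ^ 2 := by ring
          rw [h']
          linarith

end Summit.Parity.GeneralizedHardyLittlewood.Cruxes.CellParityLaw.SectionAnnihilator

end
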